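import Summits.QuantumFields.YangMills.Theorems.BalabanUVNodesN11AveragingSkewPresentationAtRecord
import Literature.MathematicalPhysics.QuantumFieldTheory.Balaban1983to89.Node00.TransportOfRecordGaugeFixingSeparated

/-!
# DAG node N11 — THE FADDEEV–POPOV WEIGHT INSIDE THE INNER READING, AT THE REGIONS OF RECORD `Ω_{j+1}(s)` (the `hY` binder discharged)

HEADER — WORK-UNIT METADATA.  Cell `pub-ymgap`, YM-PLAN Track A (HUMAN RULING D-0062), R134 fan-out seat `pub-ymgap-dag-n11-e` (g22) on node N11 [B14],
strategy s3; route `BalabanUVNodes`, key item K1⁸ `StabilityBRunRowsAtRecordR13SepCoPH` = stmt-QuantumFields-26907 (helper, `--kind proof --supports 26907 --as helper`,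
count-neutral).  [III] = [Balaban1988Convergent].  The record edition of this seat's Literature file `Node00/TransportOfRecordGaugeFixingSeparated` (g22 FILE 3, ★★★
`innerTransport_fpWeight_mul_ae_eq`: the (1.5)⇒(1.6) weight inside the inner kernel transport of the separated presentation, for a fine region `Y₀` SATURATED at level
`j+1`), over this seat's g21 `…N11AveragingSkewPresentationAtRecord` (★ `toFine_mem_compl_Omega_iff`: at def-R's regions of record the saturation of `(Ω_{j+1}(s))ᶜ` is a
THEOREM).  Asked by dag-n11-d g15 («take (o2)») for the `hin` ∕ `hinnerSum` ∕ `hinner₀`-keyed consumers `…N11TStepOfRecordSeparated(Omega)` ∕ `…N11TStepBranchSum`.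

WHAT THIS FILE PROVES (theorems only; 0 `def`, 0 `sorry`).
★★ `innerTransport_fpWeight_mul_ae_eq_Omega` — FILE 3's ★★★ at `Y₀ := (s.Ω (j+1))ᶜ` with `hY := toFine_mem_compl_Omega_iff s hj`, for any finsets `sV ⊆ bondsIn j (Ω_{j+1})ᶜ`,
`sV' ⊇ bondsIn (j+1) (Ω_{j+1})ᶜ` and gauge-fixed centres `Yfp` INSIDE `Ω_{j+1}(s)` (`toFine (j+1) y ∈ s.Ω (j+1)`); only `hj`, the two inclusions, `hYfp`, `α > 0`, `ε₀ > 0` and the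
supported invariance ∕ integrability of `ρ` stay displayed · `innerTransport_fpWeight_mul_ae_eq_Omega_of_fineGaugeInvariant` (the same for a FULLY fine-gauge-invariant `ρ`) ·
★★ `innerTransport_fpWeight_mul_ae_eq_bondsIn_Omega` (at 11a's EXACT bond sets `(Set.toFinite (bondsIn j (Ω_{j+1})ᶜ)).toFinset`, `(… (j+1) …).toFinset` — the letters of
dag-n11-w2's p615992 `…SeparatedOmega` and dag-n11-d's p616225 ∕ p617211 ∕ p619836).

HONEST FRAMING.  Helper lane, count-neutral; one-line instantiations BY NAME; nothing of Bałaban's estimates asserted; which `Yfp` print fixes at step `j` ((P″_{j+1} ∪ Z_j^{∼5})ᶜ,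
p. 265), (3.6)–(3.9), the resummation into `ζ(Ω_{j+1})`, every chart: NOT here; (B4) ∕ (S-α) ∕ (O3′) NOT closed; N11 NOT discharged; K1⁸ NOT closed; counts unmoved (typed 28∕28 ·
discharged 5∕27).  One finite `𝕋⁴` programme at fixed `ε = L^{−K}`; R4 closes only the conditional finite-𝕋⁴ rung `BalabanLadder.UV` — NOT ℝ⁴ ∕ OS ∕ mass gap ∕ Clay.  No `sorry`,
`axiom`, `def`, `instance`, `notation`.  Sources (locators only): [III] (1.5)–(1.6) p.247, (2.1) p.254, (2.21) p.258, (3.1) p.264, p.265 L.10–12.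
-/

noncomputable section

namespace Summit.QuantumFields.YangMills.Theorems.BalabanUVNodesN11GaugeFixingSeparatedAtRecord

open _root_.MeasureTheory _root_.Function
open Literature.MathematicalPhysics.QuantumFieldTheory.Balaban1983to89
open T4Continuum BlockAveraging
open B10Eq38TorusDomains (toFine)
open B10Eq42TorusConstraint (bondsIn mem_bondsIn_iff)
open B12FaddeevPopov016 (FineGauge FineGaugeInvariant fpIntegrand)
open GaugeField (gaugeAct)
open T4AveragingDisintegration (kernelTransport)
open Node00 hiding blockIter
open Summit.QuantumFields.YangMills.Theorems.BalabanUVNodesN11AveragingSkewPresentationAtRecord (toFine_mem_compl_Omega_iff)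

variable (F : T4Family) (N : ℕ) [NeZero N]

/-- ★★ **THE FADDEEV–POPOV WEIGHT INSIDE THE INNER READING, AT THE REGIONS OF RECORD.**  For a history `s`, a level `j` of the standing range, finsets `sV ⊆ bondsIn j (Ω_{j+1}(s))ᶜ`
(the carried outside variables) and `sV' ⊇ bondsIn (j+1) (Ω_{j+1}(s))ᶜ`, gauge-fixed centres `Yfp` INSIDE `Ω_{j+1}(s)`, `α > 0`, `ε₀ > 0`, and `ρ` integrable and invariant under
the fine transformations supported in the blocks over `Yfp`: with `e := (piEquivPiSubtypeProd _ (· ∈ sV)).symm` and the inner map `q ↦ (q.1, c ↦ Ū(e q)(c))` on `{c ∉ sV'}`,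
the inner kernel transport of `(fpW(Yfp)·ρ) ∘ e` is a.e. that of `ρ ∘ e` (g22 FILE 3 ★★★ with `hY := toFine_mem_compl_Omega_iff s hj`).
[cite: Balaban1988Convergent, (1.5)–(1.6) p.247, p.265 L.10–12, (2.21) p.258, (3.1) p.264] -/
theorem innerTransport_fpWeight_mul_ae_eq_Omega {ν : Stage7Numerics} {M : ℕ} {g : ℕ → ℝ} (K : ℕ) {k : ℕ} (s : SeqOfRecord F ν M g K k)
    (j : ℕ) [DecidableEq (PBond (F.P K) j)] [DecidableEq (PBond (F.P K) (j + 1))] (hj : j + 1 ≤ (F.P K).m + (F.P K).K)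
    {sV : Finset (PBond (F.P K) j)} (hsV : ∀ b : PBond (F.P K) j, b ∈ sV → b ∈ bondsIn j (s.Ω (j + 1))ᶜ)
    {sV' : Finset (PBond (F.P K) (j + 1))} (hsV' : ∀ c : PBond (F.P K) (j + 1), c ∈ bondsIn (j + 1) (s.Ω (j + 1))ᶜ → c ∈ sV')
    {α ε₀ : ℝ} (hα : 0 < α) (hε : 0 < ε₀)
    (Yfp : Finset (Site (F.P K) (j + 1))) (hYfp : ∀ y ∈ Yfp, toFine (j + 1) y ∈ s.Ω (j + 1))
    {ρ : Density (F.P K) j (SU N)}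
    (hρ : ∀ u : GaugeTransf (F.P K) j (SU N), FineGauge u → (∀ x, blockOf x ∉ Yfp → u x = 1) → ∀ U, ρ (gaugeAct u U) = ρ U)
    (hρi : Integrable ρ (fieldMeasure (F.P K) j (SU N))) :
    kernelTransport
        ((Measure.pi fun _ : ↥sV => (HaarData.haar : Measure (SU N))).prod
          (Measure.pi fun _ : {b : PBond (F.P K) j // b ∉ sV} => (HaarData.haar : Measure (SU N))))
        ((Measure.pi fun _ : ↥sV => (HaarData.haar : Measure (SU N))).prod
          (Measure.pi fun _ : {c : PBond (F.P K) (j + 1) // c ∉ sV'} => (HaarData.haar : Measure (SU N))))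
        (fun q => (q.1, fun c : {c : PBond (F.P K) (j + 1) // c ∉ sV'} =>
          (avOfRecord F N K j).avg ((MeasurableEquiv.piEquivPiSubtypeProd (fun _ : PBond (F.P K) j => SU N) (· ∈ sV)).symm q) c))
        ((fun U => (∏ y ∈ Yfp, ∏ x ∈ (block y).erase (emb y),
          (B16ZLower.zNorm (SU N) α ε₀)⁻¹ * fpIntegrand α ε₀ ((contourOfRecord F N K j).holTo U y x)) * ρ U) ∘
          ⇑(MeasurableEquiv.piEquivPiSubtypeProd (fun _ : PBond (F.P K) j => SU N) (· ∈ sV)).symm)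
      =ᵐ[(Measure.pi fun _ : ↥sV => (HaarData.haar : Measure (SU N))).prod
          (Measure.pi fun _ : {c : PBond (F.P K) (j + 1) // c ∉ sV'} => (HaarData.haar : Measure (SU N)))]
        kernelTransport
          ((Measure.pi fun _ : ↥sV => (HaarData.haar : Measure (SU N))).prod
            (Measure.pi fun _ : {b : PBond (F.P K) j // b ∉ sV} => (HaarData.haar : Measure (SU N))))
          ((Measure.pi fun _ : ↥sV => (HaarData.haar : Measure (SU N))).prod
            (Measure.pi fun _ : {c : PBond (F.P K) (j + 1) // c ∉ sV'} => (HaarData.haar : Measure (SU N))))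
          (fun q => (q.1, fun c : {c : PBond (F.P K) (j + 1) // c ∉ sV'} =>
            (avOfRecord F N K j).avg ((MeasurableEquiv.piEquivPiSubtypeProd (fun _ : PBond (F.P K) j => SU N) (· ∈ sV)).symm q) c))
          (ρ ∘ ⇑(MeasurableEquiv.piEquivPiSubtypeProd (fun _ : PBond (F.P K) j => SU N) (· ∈ sV)).symm) :=
  innerTransport_fpWeight_mul_ae_eq F N K j hj (toFine_mem_compl_Omega_iff s hj) hsV hsV' hα hε Yfp
    (fun y hy h => h (hYfp y hy)) hρ hρi

/-- The same for a FULLY fine-gauge-invariant `ρ` (`B12FaddeevPopov016.FineGaugeInvariant`, e.g. every `GaugeInvariant` density by `fineGaugeInvariant_of_gaugeInvariant`).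
[cite: Balaban1988Convergent, (1.5)–(1.6) p.247, (3.1) p.264] -/
theorem innerTransport_fpWeight_mul_ae_eq_Omega_of_fineGaugeInvariant {ν : Stage7Numerics} {M : ℕ} {g : ℕ → ℝ} (K : ℕ) {k : ℕ}
    (s : SeqOfRecord F ν M g K k) (j : ℕ) [DecidableEq (PBond (F.P K) j)] [DecidableEq (PBond (F.P K) (j + 1))] (hj : j + 1 ≤ (F.P K).m + (F.P K).K)
    {sV : Finset (PBond (F.P K) j)} (hsV : ∀ b : PBond (F.P K) j, b ∈ sV → b ∈ bondsIn j (s.Ω (j + 1))ᶜ)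
    {sV' : Finset (PBond (F.P K) (j + 1))} (hsV' : ∀ c : PBond (F.P K) (j + 1), c ∈ bondsIn (j + 1) (s.Ω (j + 1))ᶜ → c ∈ sV')
    {α ε₀ : ℝ} (hα : 0 < α) (hε : 0 < ε₀)
    (Yfp : Finset (Site (F.P K) (j + 1))) (hYfp : ∀ y ∈ Yfp, toFine (j + 1) y ∈ s.Ω (j + 1))
    {ρ : Density (F.P K) j (SU N)} (hρ : FineGaugeInvariant ρ) (hρi : Integrable ρ (fieldMeasure (F.P K) j (SU N))) :
    kernelTransport
        ((Measure.pi fun _ : ↥sV => (HaarData.haar : Measure (SU N))).prod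
          (Measure.pi fun _ : {b : PBond (F.P K) j // b ∉ sV} => (HaarData.haar : Measure (SU N))))
        ((Measure.pi fun _ : ↥sV => (HaarData.haar : Measure (SU N))).prod
          (Measure.pi fun _ : {c : PBond (F.P K) (j + 1) // c ∉ sV'} => (HaarData.haar : Measure (SU N))))
        (fun q => (q.1, fun c : {c : PBond (F.P K) (j + 1) // c ∉ sV'} =>
          (avOfRecord F N K j).avg ((MeasurableEquiv.piEquivPiSubtypeProd (fun _ : PBond (F.P K) j => SU N) (· ∈ sV)).symm q) c))
        ((fun U => (∏ y ∈ Yfp, ∏ x ∈ (block y).erase (emb y),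
          (B16ZLower.zNorm (SU N) α ε₀)⁻¹ * fpIntegrand α ε₀ ((contourOfRecord F N K j).holTo U y x)) * ρ U) ∘
          ⇑(MeasurableEquiv.piEquivPiSubtypeProd (fun _ : PBond (F.P K) j => SU N) (· ∈ sV)).symm)
      =ᵐ[(Measure.pi fun _ : ↥sV => (HaarData.haar : Measure (SU N))).prod
          (Measure.pi fun _ : {c : PBond (F.P K) (j + 1) // c ∉ sV'} => (HaarData.haar : Measure (SU N)))]
        kernelTransport
          ((Measure.pi fun _ : ↥sV => (HaarData.haar : Measure (SU N))).prod
            (Measure.pi fun _ : {b : PBond (F.P K) j // b ∉ sV} => (HaarData.haar : Measure (SU N))))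
          ((Measure.pi fun _ : ↥sV => (HaarData.haar : Measure (SU N))).prod
            (Measure.pi fun _ : {c : PBond (F.P K) (j + 1) // c ∉ sV'} => (HaarData.haar : Measure (SU N))))
          (fun q => (q.1, fun c : {c : PBond (F.P K) (j + 1) // c ∉ sV'} =>
            (avOfRecord F N K j).avg ((MeasurableEquiv.piEquivPiSubtypeProd (fun _ : PBond (F.P K) j => SU N) (· ∈ sV)).symm q) c))
          (ρ ∘ ⇑(MeasurableEquiv.piEquivPiSubtypeProd (fun _ : PBond (F.P K) j => SU N) (· ∈ sV)).symm) :=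
  innerTransport_fpWeight_mul_ae_eq_Omega F N K s j hj hsV hsV' hα hε Yfp hYfp (fun u hu _ U => hρ u hu U) hρi

/-- ★★ **AT 11a's EXACT BOND SETS** `(Set.toFinite (bondsIn j (Ω_{j+1})ᶜ)).toFinset` ∕ `(Set.toFinite (bondsIn (j+1) (Ω_{j+1})ᶜ)).toFinset` — the letters of `…SeparatedOmega` ∕
`…TStepOfRecordSeparated` ∕ `…TStepBranchSum`: only `hj`, `hYfp` (gauge-fixed blocks inside `Ω_{j+1}(s)`), `α > 0`, `ε₀ > 0` and the supported invariance ∕ integrability of `ρ`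
stay displayed. [cite: Balaban1988Convergent, (1.5)–(1.6) p.247, p.265 L.10–12, (2.21) p.258, (3.1) p.264] -/
theorem innerTransport_fpWeight_mul_ae_eq_bondsIn_Omega {ν : Stage7Numerics} {M : ℕ} {g : ℕ → ℝ} (K : ℕ) {k : ℕ} (s : SeqOfRecord F ν M g K k)
    (j : ℕ) [DecidableEq (PBond (F.P K) j)] [DecidableEq (PBond (F.P K) (j + 1))] (hj : j + 1 ≤ (F.P K).m + (F.P K).K)
    {α ε₀ : ℝ} (hα : 0 < α) (hε : 0 < ε₀)
    (Yfp : Finset (Site (F.P K) (j + 1))) (hYfp : ∀ y ∈ Yfp, toFine (j + 1) y ∈ s.Ω (j + 1))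
    {ρ : Density (F.P K) j (SU N)}
    (hρ : ∀ u : GaugeTransf (F.P K) j (SU N), FineGauge u → (∀ x, blockOf x ∉ Yfp → u x = 1) → ∀ U, ρ (gaugeAct u U) = ρ U)
    (hρi : Integrable ρ (fieldMeasure (F.P K) j (SU N))) :
    kernelTransport
        ((Measure.pi fun _ : ↥(Set.toFinite (bondsIn j (s.Ω (j + 1))ᶜ)).toFinset => (HaarData.haar : Measure (SU N))).prod
          (Measure.pi fun _ : {b : PBond (F.P K) j // b ∉ (Set.toFinite (bondsIn j (s.Ω (j + 1))ᶜ)).toFinset} =>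
            (HaarData.haar : Measure (SU N))))
        ((Measure.pi fun _ : ↥(Set.toFinite (bondsIn j (s.Ω (j + 1))ᶜ)).toFinset => (HaarData.haar : Measure (SU N))).prod
          (Measure.pi fun _ : {c : PBond (F.P K) (j + 1) // c ∉ (Set.toFinite (bondsIn (j + 1) (s.Ω (j + 1))ᶜ)).toFinset} =>
            (HaarData.haar : Measure (SU N))))
        (fun q => (q.1, fun c : {c : PBond (F.P K) (j + 1) // c ∉ (Set.toFinite (bondsIn (j + 1) (s.Ω (j + 1))ᶜ)).toFinset} =>
          (avOfRecord F N K j).avg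
            ((MeasurableEquiv.piEquivPiSubtypeProd (fun _ : PBond (F.P K) j => SU N)
              (· ∈ (Set.toFinite (bondsIn j (s.Ω (j + 1))ᶜ)).toFinset)).symm q) c))
        ((fun U => (∏ y ∈ Yfp, ∏ x ∈ (block y).erase (emb y),
          (B16ZLower.zNorm (SU N) α ε₀)⁻¹ * fpIntegrand α ε₀ ((contourOfRecord F N K j).holTo U y x)) * ρ U) ∘
          ⇑(MeasurableEquiv.piEquivPiSubtypeProd (fun _ : PBond (F.P K) j => SU N)
            (· ∈ (Set.toFinite (bondsIn j (s.Ω (j + 1))ᶜ)).toFinset)).symm)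
      =ᵐ[(Measure.pi fun _ : ↥(Set.toFinite (bondsIn j (s.Ω (j + 1))ᶜ)).toFinset => (HaarData.haar : Measure (SU N))).prod
          (Measure.pi fun _ : {c : PBond (F.P K) (j + 1) // c ∉ (Set.toFinite (bondsIn (j + 1) (s.Ω (j + 1))ᶜ)).toFinset} =>
            (HaarData.haar : Measure (SU N)))]
        kernelTransport
          ((Measure.pi fun _ : ↥(Set.toFinite (bondsIn j (s.Ω (j + 1))ᶜ)).toFinset => (HaarData.haar : Measure (SU N))).prod
            (Measure.pi fun _ : {b : PBond (F.P K) j // b ∉ (Set.toFinite (bondsIn j (s.Ω (j + 1))ᶜ)).toFinset} =>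
              (HaarData.haar : Measure (SU N))))
          ((Measure.pi fun _ : ↥(Set.toFinite (bondsIn j (s.Ω (j + 1))ᶜ)).toFinset => (HaarData.haar : Measure (SU N))).prod
            (Measure.pi fun _ : {c : PBond (F.P K) (j + 1) // c ∉ (Set.toFinite (bondsIn (j + 1) (s.Ω (j + 1))ᶜ)).toFinset} =>
              (HaarData.haar : Measure (SU N))))
          (fun q => (q.1, fun c : {c : PBond (F.P K) (j + 1) // c ∉ (Set.toFinite (bondsIn (j + 1) (s.Ω (j + 1))ᶜ)).toFinset} =>
            (avOfRecord F N K j).avg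
              ((MeasurableEquiv.piEquivPiSubtypeProd (fun _ : PBond (F.P K) j => SU N)
                (· ∈ (Set.toFinite (bondsIn j (s.Ω (j + 1))ᶜ)).toFinset)).symm q) c))
          (ρ ∘ ⇑(MeasurableEquiv.piEquivPiSubtypeProd (fun _ : PBond (F.P K) j => SU N)
            (· ∈ (Set.toFinite (bondsIn j (s.Ω (j + 1))ᶜ)).toFinset)).symm) :=
  innerTransport_fpWeight_mul_ae_eq_Omega F N K s j hj (fun b hb => (mem_toFinite_bondsIn_toFinset_iff _ b).1 hb)
    (fun c hc => (mem_toFinite_bondsIn_toFinset_iff _ c).2 hc) hα hε Yfp hYfp hρ hρi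

end Summit.QuantumFields.YangMills.Theorems.BalabanUVNodesN11GaugeFixingSeparatedAtRecord

end
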